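import Summits.CriticalPhenomena.Ising3DConformalLimit.Theorems.EnergyNotSigmaSquaredGapForcesFarMergingScreeningDefs

/-!
# Objects of the line `screening-form-lemma-a1` for the crux `GapForcesFarMerging`, part 2:
# the two currencies of the lead's reshape of the far-screening transfer
(item stmt-CriticalPhenomena-4468; route decl
`Summit.CriticalPhenomena.Ising3DConformalLimit.Theses.EnergyNotSigmaSquared.GapForcesFarMerging`;
lead seat c2 `prover-line-stmt-CriticalPhenomena-4468-c2-0`; part 1 is
`Theorems/EnergyNotSigmaSquaredGapForcesFarMergingScreeningDefs.lean`, whose vocabulary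
`pinchScreen`, `meanScreening`, `DoublingWindow`, `RootOpacityIO`, `FarScreeningIO`, `up`, `dn`, `e₂` is used verbatim)

Route-posited objects (D-0016). The registered stub
`stub_farScreening : HittingLowerBound → RootOpacityIO → FarScreeningIO` of the line takes an OPAQUE
WINDOWED ROOT OCTAVE `k` of the one-pinch screening ladder `A(r;m) = pinchScreen n r m` — a relative drop
`A(2^{k+1};m) ≤ (1-c)·A(2^k;m)` for SOME far scale `m ≥ 2^{k+3}` — to far screening of a FIXED injective shape
along infinitely many dilations. As filed, the far scale `m` may exceed the octave `2^k` by an unbounded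
factor, so the stub silently contains, on top of the un-tilting / un-pinning of the probe at scale `2^k`, a
far-source insensitivity statement (the far ends `up m`, `dn m` must be moved down to bounded aspect before
any fixed dilated shape can appear: the counting behind `RootOpacityIO` cannot place the opaque octave near the
top of the ladder, because the hypothesis GAP is only an UPPER bound on the full avoidance). The reshape
separates the two:

* `HazardRelocation` — opacity of the octave `k` for a far scale `m ≥ 2^{k+3}` implies opacity of the same octave
  for the far scale `2^{k+3}` (aspect `8`), with a constant depending only on the drop: insensitivity of the
  per-octave hazard of the ladder to the position of the far ends (a ratio-form relocation statement; the
  qualitative, non-uniform version is the sourced incipient-infinite-cluster limit of Panis 2025, Thm 3.1);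
* `Unpin` — THE CORE: at a windowed octave `k` that is opaque for the bounded-aspect far scale `2^{k+3}`, some
  FRESH probe strand started from a coarse lattice point `2^{k-j}·u`, `u` in a finite family `F`, is screened by
  the full duplicated cluster of the strand `0 → up 2^{k+3}` by a definite fraction — the un-tilting (the
  hypothesis is a statement under the screening tilt `𝟙[e₂, dn ∉ C]·S(C_{2^k})`) and un-pinning (the pinned
  probe source `e₂` is replaced by a source at scale `2^k`) of ONE passage at ONE scale, far ends untouched.

The glue `HazardRelocation → Unpin → RootOpacityIO → FarScreeningIO` (filters + a pigeonhole over the finite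
family `F`; the dilated shape is `y_u = (0, up 2^{j+3}, u, dn 2^{j+3})`, `L = 2^{k-j}`) is proved in
`Theorems/EnergyNotSigmaSquaredGapForcesFarMergingScreeningUnpinGlue.lean`. Neither currency is a literature
fact; both are statements about the nearest-neighbour model's box trace laws `sourcedDoubleCurrentLaw 3 n β_c`
only. References for the intended proofs: Aizenman–Duminil-Copin 2021 (arXiv:1912.07973) §6.2 (mixing /
relocation of sources at regular scales, `d = 4`), R. Panis, PTRF 194 (2025) Thm 2.4 / 3.1 (qualitative
sourced mixing and the sourced IIC, `d ≥ 3`), Lawler 1991 ch. 3–5 (separation lemmas, the template of the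
un-pinning).
-/

noncomputable section

namespace Summit.CriticalPhenomena.Ising3DConformalLimit.GapForcesFarMergingScreening

open scoped symmDiff ENNReal
open MeasureTheory Filter Finset
open Literature.Probability.LatticeModels Literature.Probability.Percolation
open Summit.CriticalPhenomena.Ising3DConformalLimit.Theorems.GapForcesFarMerging.Negative
  (e₁ e₂ cc2 xR up dn FarMergingShape SinglePinchLawShape)

/-! ### Currencies of the reshaped far end -/

/-- (C6a) HAZARD RELOCATION (far-source insensitivity of the per-octave hazard of the one-pinch screening
ladder, ratio form): for every drop `c > 0` there is `c' > 0` such that, for all large octaves `k`, every far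
scale `m ≥ 2^{k+3}` and all large box sizes `n`, an octave-`k` relative drop `≥ c` of the ladder with far ends
`up m, dn m` forces an octave-`k` relative drop `≥ c'` of the ladder with far ends at the bounded-aspect scale
`2^{k+3}` (together with the positivity of that ladder at radius `2^k`). Statement of the registered (open) stub
`stub_hazardRelocation` (route-posited currency of the line, not a literature fact; the qualitative, non-uniform
far-end insensitivity is Panis' sourced IIC limit, the uniformity in `k` is the open content). -/
def HazardRelocation : Prop :=
  ∀ c : ℝ, 0 < c → ∃ c' : ℝ, 0 < c' ∧ ∀ᶠ k : ℕ in atTop, ∀ m : ℕ, 2 ^ (k + 3) ≤ m →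
    ∀ᶠ n : ℕ in atTop,
      (0 < pinchScreen n (2 ^ k) m ∧ pinchScreen n (2 ^ (k + 1)) m ≤ (1 - c) * pinchScreen n (2 ^ k) m) →
        (0 < pinchScreen n (2 ^ k) (2 ^ (k + 3)) ∧
          pinchScreen n (2 ^ (k + 1)) (2 ^ (k + 3)) ≤ (1 - c') * pinchScreen n (2 ^ k) (2 ^ (k + 3)))

/-- The far-screening shape with an un-pinned probe source `u`: strand `0 → up a`, probe `u → dn a`. [folklore] -/
def unpinShape (a : ℕ) (u : Site 3) : Fin 4 → Site 3 := ![0, up a, u, dn a]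

/-- (C6b) UN-PINNING AT A BOUNDED-ASPECT OPAQUE WINDOWED OCTAVE (the core of the transfer): for every drop `c > 0`
and window constant `θ > 0` there are `c' > 0`, a granularity `j` and a finite family `F` of lattice points,
each giving an injective shape `unpinShape 2^{j+3} u = (0, up 2^{j+3}, u, dn 2^{j+3})`, such that for all large
octaves `k` inside a `θ`-doubling window and all large box sizes `n`: IF the ladder with far ends at `2^{k+3}` is
positive at radius `2^k` and drops by the factor `1 - c` across the octave `Λ_{2^{k+1}} ∖ Λ_{2^k}` (the TILTED
pinned probe `e₂ → dn 2^{k+3}` is cut there with probability `≥ c`), THEN for some `u ∈ F` the full duplicated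
cluster of the strand `0 → up 2^{k+3}` screens the FRESH probe pair `(2^{k-j}·u, dn 2^{k+3})` by at least `c'`:
`meanScreening ≤ 1 - c'`. Statement of the registered (open, hardest) stub `stub_unpin` (route-posited currency
of the line, not a literature fact; template: the separation lemmas of Lawler 1991 ch. 3–5). -/
def Unpin : Prop :=
  ∀ c θ : ℝ, 0 < c → 0 < θ → ∃ c' : ℝ, 0 < c' ∧ ∃ j : ℕ, ∃ F : Finset (Site 3),
    (∀ u ∈ F, Function.Injective (unpinShape (2 ^ (j + 3)) u)) ∧
    ∀ᶠ k : ℕ in atTop, DoublingWindow θ k → ∀ᶠ n : ℕ in atTop,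
      (0 < pinchScreen n (2 ^ k) (2 ^ (k + 3)) ∧
        pinchScreen n (2 ^ (k + 1)) (2 ^ (k + 3)) ≤ (1 - c) * pinchScreen n (2 ^ k) (2 ^ (k + 3))) →
        ∃ u ∈ F, meanScreening n n 0 (up (2 ^ (k + 3))) ((((2 ^ (k - j) : ℕ) : ℤ)) • u) (dn (2 ^ (k + 3))) ≤
          1 - c'

/-! ### Sanity lemmas (definitional) -/

/-- The points of the un-pinned shape (definitional). [folklore] -/
theorem unpinShape_apply (a : ℕ) (u : Site 3) :
    unpinShape a u 0 = 0 ∧ unpinShape a u 1 = up a ∧ unpinShape a u 2 = u ∧ unpinShape a u 3 = dn a :=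
  ⟨rfl, rfl, rfl, rfl⟩

/-- Dilating the far end `up a` by `L` gives `up (a·L)`. [folklore] -/
theorem zsmul_up : ∀ a L : ℕ, (L : ℤ) • up a = up (a * L) := by
  intro a L; ext j; fin_cases j <;> simp [up, xR] <;> ring

/-- Dilating the far end `dn a` by `L` gives `dn (a·L)`. [folklore] -/
theorem zsmul_dn : ∀ a L : ℕ, (L : ℤ) • dn a = dn (a * L) := by
  intro a L; ext j; fin_cases j <;> simp [dn, xR] <;> ring

/-- Dilating the un-pinned shape: `L • unpinShape a u = (0, up (aL), L•u, dn (aL))`, read coordinatewise as the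
four arguments of `meanScreening` in `FarScreeningIO`. [folklore] -/
theorem zsmul_unpinShape (a L : ℕ) (u : Site 3) :
    (L : ℤ) • unpinShape a u 0 = 0 ∧ (L : ℤ) • unpinShape a u 1 = up (a * L) ∧
      (L : ℤ) • unpinShape a u 2 = (L : ℤ) • u ∧ (L : ℤ) • unpinShape a u 3 = dn (a * L) := by
  refine ⟨by simp [unpinShape], ?_, rfl, ?_⟩
  · show (L : ℤ) • up a = up (a * L); exact zsmul_up a L
  · show (L : ℤ) • dn a = dn (a * L); exact zsmul_dn a L


/-! ### Flexible-aspect forms (appended by the lead, seat c2, same cycle)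

The pair (`HazardRelocation`, `Unpin`) fixes the bounded aspect to `8` (`far scale = 2^{k+3}`). A proof of the relocation by a
boundary-Harnack comparison of the inside laws under a change of the far source can only be expected to have constants
tending to `1` as the target aspect grows (gradient estimate `|G(x) - G(y)| ≤ C|x-y|G(x)/|x|` for the deterministic part), and a
weak opacity (`c` small) survives a relocation only if those constants are close enough to `1`. The flexible forms let the
target aspect `2^A` depend on the drop `c`: `HazardRelocationFlex` is WEAKER than `HazardRelocation` (take `A = 3`), `UnpinFlex`
asks `Unpin` at every aspect `A` (each instance is the same one-scale un-tilt/un-pin statement), and the glue is unchanged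
(`farScreening_of_unpinFlex`, file …ScreeningUnpinGlueFlex.lean). -/

/-- (C6a′) HAZARD RELOCATION, flexible aspect: for every drop `c > 0` there are a target aspect `A ≥ 3` and `c' > 0` such that for
all large octaves `k`, every far scale `m ≥ 2^{k+3}` and all large `n`, an octave-`k` drop `≥ c` of the ladder with far ends at
`m` forces an octave-`k` drop `≥ c'` (and positivity) of the ladder with far ends at `2^{k+A}`. Weaker than `HazardRelocation`.
Statement of the registered (open) stub `stub_hazardRelocationFlex` (route-posited currency of the line, not a literature fact). -/
def HazardRelocationFlex : Prop :=
  ∀ c : ℝ, 0 < c → ∃ A : ℕ, 3 ≤ A ∧ ∃ c' : ℝ, 0 < c' ∧ ∀ᶠ k : ℕ in atTop, ∀ m : ℕ, 2 ^ (k + 3) ≤ m →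
    ∀ᶠ n : ℕ in atTop,
      (0 < pinchScreen n (2 ^ k) m ∧ pinchScreen n (2 ^ (k + 1)) m ≤ (1 - c) * pinchScreen n (2 ^ k) m) →
        (0 < pinchScreen n (2 ^ k) (2 ^ (k + A)) ∧
          pinchScreen n (2 ^ (k + 1)) (2 ^ (k + A)) ≤ (1 - c') * pinchScreen n (2 ^ k) (2 ^ (k + A)))

/-- (C6b′) UN-PINNING at an opaque windowed octave of bounded aspect `2^A`, for EVERY `A`: for all `A`, `c > 0`, `θ > 0` there
are `c' > 0`, a granularity `j` and a finite family `F` (each `unpinShape 2^{j+A} u` injective) such that for all large windowed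
`k` and large `n`, an octave-`k` drop `≥ c` of the ladder with far ends at `2^{k+A}` forces, for some `u ∈ F`, a screening
`≤ 1 - c'` of the fresh probe from `2^{k-j}·u` to `dn 2^{k+A}` by the full cluster of the strand `0 → up 2^{k+A}`. Its instance
`A = 3` is `Unpin`. Statement of the registered (open, hardest) stub `stub_unpinFlex` (route-posited currency of the line). -/
def UnpinFlex : Prop :=
  ∀ A : ℕ, ∀ c θ : ℝ, 0 < c → 0 < θ → ∃ c' : ℝ, 0 < c' ∧ ∃ j : ℕ, ∃ F : Finset (Site 3),
    (∀ u ∈ F, Function.Injective (unpinShape (2 ^ (j + A)) u)) ∧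
    ∀ᶠ k : ℕ in atTop, DoublingWindow θ k → ∀ᶠ n : ℕ in atTop,
      (0 < pinchScreen n (2 ^ k) (2 ^ (k + A)) ∧
        pinchScreen n (2 ^ (k + 1)) (2 ^ (k + A)) ≤ (1 - c) * pinchScreen n (2 ^ k) (2 ^ (k + A))) →
        ∃ u ∈ F, meanScreening n n 0 (up (2 ^ (k + A))) ((((2 ^ (k - j) : ℕ) : ℤ)) • u) (dn (2 ^ (k + A))) ≤
          1 - c'

/-- `HazardRelocation` (aspect `8`) implies its flexible form (take `A = 3`). [folklore] -/
theorem hazardRelocationFlex_of_hazardRelocation : HazardRelocation → HazardRelocationFlex :=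
  fun h c hc => ⟨3, le_rfl, h c hc⟩

/-- `UnpinFlex` at `A = 3` is `Unpin`. [folklore] -/
theorem unpin_of_unpinFlex : UnpinFlex → Unpin := fun h => h 3


/-! ### Large-aspect forms (second append by the lead, seat c2, after the wave-2 diagnosis of `stub_hazardRelocation`)

Comparability of the SURVIVALS `A(2^{k+1};·)/A(2^k;·)` up to a fixed constant `K` transfers only drops `c > 1 - 1/K`;
transferring every drop needs either comparability of the DROPS up to constants at aspect `8` (the target of
`HazardRelocation`, an up-to-constants boundary-Harnack principle for sourced currents) or constants `1 + δ`, `δ → 0`,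
which is only plausible when BOTH far scales have aspect `→ ∞` (ratio convergence to the sourced IIC with a rate). The
flexible form `HazardRelocationFlex` keeps the hypothesis at `m ≥ 2^{k+3}` and so still compares aspect `8` with
aspect `2^A`. The forms below put BOTH far scales beyond `2^{k+A}` and let the counting deliver such octaves for every
`A` (`RootOpacityFarIO`: shifting the admissible octave range by finitely many octaves does not change densities);
the window hypothesis is made available to the relocation, as the glue has it in scope. Glue:
`farScreening_of_unpinFar : HazardRelocationFar → UnpinFlex → RootOpacityFarIO → FarScreeningIO`
(file …ScreeningUnpinGlueFar.lean); `HazardRelocationFlex → HazardRelocationFar`. -/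

/-- (C4″) ROOT OPACITY AT EVERY ASPECT: there are `c, θ > 0` such that for EVERY `A`, infinitely many `θ`-windowed
octaves `k` carry a relative drop `≥ c` of the ladder for some far scale `m ≥ 2^{k+A}`, frequently in the box size.
(Output of the counting `OnePinchScreeningDecay → Floors → RootOpacityFarIO`, registered stub `stub_rootOpacityFar`,
provable now: the landed density counting with the top `A` octaves excluded; route-posited currency of the line.) -/
def RootOpacityFarIO : Prop :=
  ∃ c θ : ℝ, 0 < c ∧ 0 < θ ∧ ∀ A : ℕ, ∃ᶠ k : ℕ in atTop, DoublingWindow θ k ∧ ∃ m : ℕ, 2 ^ (k + A) ≤ m ∧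
    ∃ᶠ n : ℕ in atTop, 0 < pinchScreen n (2 ^ k) m ∧
      pinchScreen n (2 ^ (k + 1)) m ≤ (1 - c) * pinchScreen n (2 ^ k) m

/-- (C6a″) HAZARD RELOCATION AT LARGE ASPECT: for every drop `c > 0` and window constant `θ > 0` there are an aspect
`A ≥ 3` and `c' > 0` such that for all large `θ`-windowed octaves `k`, every far scale `m ≥ 2^{k+A}` and all large `n`,
an octave-`k` drop `≥ c` with far ends at `m` forces an octave-`k` drop `≥ c'` (and positivity) with far ends at
`2^{k+A}` — both far scales beyond the aspect `2^A` chosen by the drop. Weaker than `HazardRelocationFlex`. Statement of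
the registered (open) stub `stub_hazardRelocationFar` (route-posited currency of the line, not a literature fact). -/
def HazardRelocationFar : Prop :=
  ∀ c θ : ℝ, 0 < c → 0 < θ → ∃ A : ℕ, 3 ≤ A ∧ ∃ c' : ℝ, 0 < c' ∧ ∀ᶠ k : ℕ in atTop, DoublingWindow θ k →
    ∀ m : ℕ, 2 ^ (k + A) ≤ m → ∀ᶠ n : ℕ in atTop,
      (0 < pinchScreen n (2 ^ k) m ∧ pinchScreen n (2 ^ (k + 1)) m ≤ (1 - c) * pinchScreen n (2 ^ k) m) →
        (0 < pinchScreen n (2 ^ k) (2 ^ (k + A)) ∧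
          pinchScreen n (2 ^ (k + 1)) (2 ^ (k + A)) ≤ (1 - c') * pinchScreen n (2 ^ k) (2 ^ (k + A)))

/-- `HazardRelocationFlex` implies the large-aspect form (restrict to `m ≥ 2^{k+A} ≥ 2^{k+3}`, ignore the window). [folklore] -/
theorem hazardRelocationFar_of_hazardRelocationFlex : HazardRelocationFlex → HazardRelocationFar := by
  intro h c θ hc _
  obtain ⟨A, hA, c', hc', hk⟩ := h c hc
  refine ⟨A, hA, c', hc', hk.mono fun k hkk _ m hm => hkk m ?_⟩
  exact le_trans (Nat.pow_le_pow_right (by norm_num) (by omega)) hm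

/-- Root opacity at every aspect implies root opacity (take `A = 3`). [folklore] -/
theorem rootOpacityIO_of_rootOpacityFarIO : RootOpacityFarIO → RootOpacityIO := by
  rintro ⟨c, θ, hc, hθ, h⟩
  exact ⟨c, θ, hc, hθ, h 3⟩

end Summit.CriticalPhenomena.Ising3DConformalLimit.GapForcesFarMergingScreening

end
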